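import Summits.BirchSwinnertonDyer.BirchSwinnertonDyer.Theorems.AlignedTransportAtTwoMainConjectureOfRankZeroBSDAtTwoOrdinaryStandardShapeExact
import HarnessLib

/-!
# Route `AlignedTransportAtTwo`, crux C2 `MainConjectureOfRankZeroBSDAtTwo` (stmt-BirchSwinnertonDyer-22298):
# THE NAMED INPUT IN INTEGER-TRIPLE CURRENCY IS EQUIVALENT TO THE LOCAL-CELL INPUT — «narrow `μ₂⁺ = 0` for every cubic field containing a root of a
# shape cubic `u³ + (1+4a₂)u² + 16a₄u + 64a₆` (`a₄ + a₆` odd, no rational root, `Δ ∉ ℤ²`)» ⟺ «narrow `μ₂⁺ = 0` for every cubic field containing a root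
# of `c_W`, `W` globally minimal, good ordinary at `2`, `W(ℚ)[2] = 0`, `Δ_W ∉ ℚ²`»; C2 BY NAME from it + PRINT⁵ + MuIneqʳ; the registered stub PFμ⁺ from it

HONEST FRAMING. WIDTH-5 attached prover seat `bsd-line-att-p4` g35 on line `birth` of the lead `bsd-line-att-p2` (WAKE-only); `--supports`
stmt-BirchSwinnertonDyer-22298, closes nothing; BSD is NOT proved; crux C2, its verdict «blocked-on `Rank1Residual.GreenbergMuConjectureIrreducible`»
and every registered stub (P / T / Kμ / LimDoor / MuIneqʳ / PFμ⁺ of `Lines/birth.lean` v9) untouched. THEOREMS ONLY (no `def`, no named fact, no `sorry`).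
The doors of §2–§3 are CONDITIONAL on displayed named print facts (PRINT⁵ = Kato 17.4 (1)(2) at `2` `h17`, Greenberg 1999 Thm. 4.1 `hGr`, period unit
`hper`, modularity `hmod`, GZK `hGZK`) and on the registered stub MuIneqʳ VERBATIM (`hI`); the shape input `hS` is an OPEN instance of Iwasawa's `μ = 0`
conjecture / Greenberg–Kida (narrow form) — nothing is asserted about it. §1 is UNCONDITIONAL. Crux-side sequel of `…OrdinaryStandardShape` (the
`ℤ`-normal form) and `…OrdinaryStandardShapeExact` (the exact image), this seat, same gen.

Write SHAPE for «∀ `a₂ a₄ a₆ : ℤ`, `a₄ + a₆` odd, `x³ + (1+4a₂)x² + 16a₄x + 64a₆` without rational root, `Δ[1,a₂,0,a₄,a₆]` not a square ⟹ every cubic number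
field `F ∋ e` with `e³ + (1+4a₂)e² + 16a₄e + 64a₆ = 0` has (a) `μ = 0` (growth form) along every cyclotomic `ℤ₂`-extension and (b) bounded narrow
`2`-defect along them», and LOCAL for «∀ `W/ℚ` elliptic, globally minimal, good ordinary at `2`, `W(ℚ)[2] = 0`, `Δ_W ∉ ℚ²` ⟹ every cubic number field
`F ∋ e` with `c_W(e) = 0` has (a) ∧ (b)» (C2's PFμ⁺-type input in g33's cubic currency, stripped of `¬CM`, `r_an = 0`, `BSD₂`, `μ_an`).

* §1 ★★★ `narrowMu_standardShape_iff_localCell` — **SHAPE ⟺ LOCAL**, UNCONDITIONAL (⟹: the `ℤ`-normal form of a cell curve, `c_W(e) = 0 ⟺ g(e − 4r) = 0`,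
  `Δ[1,a₂,0,a₄,a₆] = Δ_min(W)`; ⟸: the exact image — the minimised standard model and its rational affinity of roots). So the integer-triple named input
  is NOT a strengthening of the curve-indexed one: the two restatements of C2's open input coincide.
* §2 ★★★ `crux_of_forall_standardShape_cubicField_narrowClassicalMu` — **SHAPE + PRINT⁵ + MuIneqʳ ⟹ `MainConjectureOfRankZeroBSDAtTwo`** (closer ONE line
  through §1 and g33's `crux_of_forall_cubicField_root_narrowClassicalMu`).
* §3 glue from the FIELD binders of the restatement menu (g33 v12 «non-cyclic», g34 «dyadic», «dyadic-even») to SHAPE: `standardShape_of_narrowMu_nonGalois_cubic`,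
  `standardShape_of_narrowMu_dyadic`, `standardShape_of_narrowMu_dyadicEven` (a root field of a shape cubic is not Galois, embeds into `ℚ₂`, has `v₂(d_F)`
  even — `…OrdinaryStandardShapeExact` §2). The converse «dyadic-even ⟹ shape» would be the FIELD-currency exactness (every dyadic-even `S₃`-cubic is a
  root field of a shape cubic — a `2`-adic density statement), not attempted.
* §4 ★★ `pointFieldMuCyc_of_forall_standardShape_cubicField_narrowClassicalMu` — the REGISTERED STUB PFμ⁺ (`PointFieldMuCycAtTwo`, body verbatim) from SHAPE.
RESTATEMENT MENU (D-0014): the planner may file `NarrowMuTwoOfOrdinaryStandardShape : Prop` (= SHAPE verbatim) [conjecture; OPEN IN PRINT — Iwasawa's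
`μ = 0` conjecture for the complex root fields, Greenberg–Kida narrow `μ₂⁺ = 0` for the totally real ones]; chain of the menu:
v12 ⟹ dyadic ⟹ dyadic-even ⟹ SHAPE ⟺ LOCAL ⟸ C2 (+ PRINT + `hGi`, g33 §3). Expected REF2 grade COROLLARY-OF-TREE. PARTITION: none; beyond-print theorem:
no; BSD is NOT proved by any of this.

References: [Greenberg2001IwasawaPastPresent] §4; [Kida1982JFields] Thm. 1, Remark (ii); [Iwasawa1973MuInvariants] §3–§4; [Kato2004Asterisque] Thm. 17.4;
[GreenbergLNM1716] Thm. 4.1; [SilvermanAEC2009] III.§1, VIII.§8; tree: `…NarrowCubicNamedInput{,Dyadic}` (g33/g34), `…CubicDiscriminantSquareClass` (g34),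
`…OrdinaryStandardShape{,Exact}` (g35), `ClassicalMuVanishesAdjoinIOfNarrow`.
-/

-- the Theorems namespace of this sub repeats the summit name by design (D-0017 nested layout)
set_option linter.dupNamespace false
set_option autoImplicit false

noncomputable section

open scoped NumberField IntermediateField

namespace Summit.BirchSwinnertonDyer.BirchSwinnertonDyer.Theorems.AlignedTransportAtTwoOrdinaryStandardShapeCrux

open NumberField Polynomial WeierstrassCurve IntermediateField Field CongruenceSubgroup
  Literature.NumberTheory.EllipticCurves Literature.NumberTheory.EllipticCurves.Greenberg1999
  Literature.NumberTheory.EllipticCurves.ModularForms Literature.NumberTheory.EllipticCurves.Rank1Residual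
  Literature.NumberTheory.EllipticCurves.Module
  Literature.NumberTheory.EllipticCurves.DokchitserDokchitser2012
  Literature.NumberTheory.EllipticCurves.ZpExtension Literature.NumberTheory.GaloisRepresentations
  Literature.NumberTheory.IwasawaTheory Literature.NumberTheory.NumberFields
  Summit.BirchSwinnertonDyer.Rank1Residual Summit.BirchSwinnertonDyer.Rank1Residual.X1.MuLambda
  Summit.BirchSwinnertonDyer.Rank1Residual.X5 Summit.BirchSwinnertonDyer.Rank1Residual.F1Sign2
  Summit.BirchSwinnertonDyer.BirchSwinnertonDyer.Theorems.Rank1ResidualX1Defs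
  Summit.BirchSwinnertonDyer.BirchSwinnertonDyer.Theses.AlignedTransportAtTwo
  Summit.BirchSwinnertonDyer.BirchSwinnertonDyer.Theorems.AlignedTransportAtTwoNarrowCubicNamedInput
  Summit.BirchSwinnertonDyer.BirchSwinnertonDyer.Theorems.AlignedTransportAtTwoNarrowCubicNamedInputDyadic
  Summit.BirchSwinnertonDyer.BirchSwinnertonDyer.Theorems.AlignedTransportAtTwoCubicDiscriminantSquareClass
  Summit.BirchSwinnertonDyer.BirchSwinnertonDyer.Theorems.AlignedTransportAtTwoOrdinaryStandardShape
  Summit.BirchSwinnertonDyer.BirchSwinnertonDyer.Theorems.AlignedTransportAtTwoOrdinaryStandardShapeExact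
  Summit.BirchSwinnertonDyer.BirchSwinnertonDyer.Theorems.AlignedTransportAtTwoBridge
  Summit.BirchSwinnertonDyer.BirchSwinnertonDyer.Theorems.AlignedTransportAtTwoFineRoad.DivisionCubic
  Summit.BirchSwinnertonDyer.BirchSwinnertonDyer.Theorems.AlignedTransportAtTwoPointFieldCarrierCM
  Summit.BirchSwinnertonDyer.BirchSwinnertonDyer.Theorems.AlignedTransportAtTwoPointFieldCarrierCMIff
  Summit.BirchSwinnertonDyer.BirchSwinnertonDyer.Theorems.AlignedTransportAtTwoSharedCubicDivisionField
  Summit.BirchSwinnertonDyer.BirchSwinnertonDyer.Theorems.AlignedTransportAtTwoCMSexticCurrency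
  Summit.BirchSwinnertonDyer.BirchSwinnertonDyer.Theorems.AlignedTransportAtTwoCMSexticFieldDoor

/-! ## §1 SHAPE ⟺ LOCAL (unconditional) -/

section Equivalence

/-- **SHAPE ⟹ LOCAL**: if every cubic field containing a root of a shape cubic (`a₄ + a₆` odd, no rational root, `Δ[1,a₂,0,a₄,a₆] ∉ ℤ²`) has narrow
`μ₂⁺ = 0`, then so does every cubic field containing a root of `c_W` for `W/ℚ` elliptic, globally minimal, good ordinary at `2`, with `W(ℚ)[2] = 0` and
`Δ_W ∉ ℚ²` (the `ℤ`-normal form: `c_W(e) = 0 ⟺ g(e − 4r) = 0`, `Δ[1,a₂,0,a₄,a₆] = Δ_min(W)`). UNCONDITIONAL; nothing asserted about either side.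
[cite: SilvermanAEC2009, III.§1 Table 3.1 and VIII.§8] [cite: Kida1982JFields, Remark (ii) (p. 341)] -/
theorem localCell_of_narrowMu_standardShape
    (hS : ∀ a₂ a₄ a₆ : ℤ, Odd (a₄ + a₆) →
      (∀ x : ℚ, x ^ 3 + (1 + 4 * (a₂ : ℚ)) * x ^ 2 + 16 * (a₄ : ℚ) * x + 64 * (a₆ : ℚ) ≠ 0) →
      ¬ IsSquare (⟨1, a₂, 0, a₄, a₆⟩ : WeierstrassCurve ℤ).Δ →
      ∀ (F : Type) [Field F] [NumberField F], Module.finrank ℚ F = 3 →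
      ∀ e : F, e ^ 3 + (1 + 4 * (a₂ : F)) * e ^ 2 + 16 * (a₄ : F) * e + 64 * (a₆ : F) = 0 →
      (∀ κ : ZpExtension F 2, κ.IsCyclotomic → ClassicalMuVanishes κ) ∧
        ∃ D : ℕ, ∀ κ : ZpExtension F 2, κ.IsCyclotomic → ∀ n : ℕ, ∀ [NumberField ↥(κ.layer n)],
          padicValNat 2 (narrowClassNumber ↥(κ.layer n)) ≤ padicValNat 2 (classNumber ↥(κ.layer n)) + D) :
    ∀ (W : WeierstrassCurve ℚ) [W.IsElliptic] [W.IsGloballyMinimal], IsOrdinaryAt W 2 →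
      (∀ x : ℚ, ¬ HasRationalTwoTorsionX W x) → ¬ IsSquare W.Δ →
      ∀ (F : Type) [Field F] [NumberField F], Module.finrank ℚ F = 3 → ∀ e : F, aeval e (twoDivisionUCubic W) = 0 →
      (∀ κ : ZpExtension F 2, κ.IsCyclotomic → ClassicalMuVanishes κ) ∧
        ∃ D : ℕ, ∀ κ : ZpExtension F 2, κ.IsCyclotomic → ∀ n : ℕ, ∀ [NumberField ↥(κ.layer n)],
          padicValNat 2 (narrowClassNumber ↥(κ.layer n)) ≤ padicValNat 2 (classNumber ↥(κ.layer n)) + D := by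
  intro W _ _ hord ht hsq F _ _ hF e he
  obtain ⟨a₂, a₄, a₆, r, hodd, hΔ, hroot⟩ := exists_standardShape_of_isOrdinaryAt W hord
  have hnsq : ¬ IsSquare (⟨1, a₂, 0, a₄, a₆⟩ : WeierstrassCurve ℤ).Δ := by
    rw [hΔ]
    rintro ⟨s, hs⟩
    exact hsq ⟨s, by rw [← cast_minimalDiscriminantInt W, hs]; push_cast; ring⟩
  exact hS a₂ a₄ a₆ hodd (shape_ne_zero_of_forall_not_hasRationalTwoTorsionX W ht hroot) hnsq F hF (e - 4 * (r : F))
    ((hroot e).mp he)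

/-- **LOCAL ⟹ SHAPE**: conversely, if every cubic field containing a root of `c_W` (`W` as above) has narrow `μ₂⁺ = 0`, then so does every cubic field
containing a root of a shape cubic — by THE EXACT IMAGE (`…OrdinaryStandardShapeExact`: a root of a shape cubic is, after a rational affinity, a root of
the `u`-cubic of a globally minimal good-ordinary curve with `W(ℚ)[2] = 0`, `Δ ∉ ℚ²`; Néron). UNCONDITIONAL; nothing asserted about either side.
[cite: SilvermanAEC2009, VIII.§8 Cor. 8.3] [cite: Neron1964] -/
theorem narrowMu_standardShape_of_localCell
    (hL : ∀ (W : WeierstrassCurve ℚ) [W.IsElliptic] [W.IsGloballyMinimal], IsOrdinaryAt W 2 →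
      (∀ x : ℚ, ¬ HasRationalTwoTorsionX W x) → ¬ IsSquare W.Δ →
      ∀ (F : Type) [Field F] [NumberField F], Module.finrank ℚ F = 3 → ∀ e : F, aeval e (twoDivisionUCubic W) = 0 →
      (∀ κ : ZpExtension F 2, κ.IsCyclotomic → ClassicalMuVanishes κ) ∧
        ∃ D : ℕ, ∀ κ : ZpExtension F 2, κ.IsCyclotomic → ∀ n : ℕ, ∀ [NumberField ↥(κ.layer n)],
          padicValNat 2 (narrowClassNumber ↥(κ.layer n)) ≤ padicValNat 2 (classNumber ↥(κ.layer n)) + D) :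
    ∀ a₂ a₄ a₆ : ℤ, Odd (a₄ + a₆) →
      (∀ x : ℚ, x ^ 3 + (1 + 4 * (a₂ : ℚ)) * x ^ 2 + 16 * (a₄ : ℚ) * x + 64 * (a₆ : ℚ) ≠ 0) →
      ¬ IsSquare (⟨1, a₂, 0, a₄, a₆⟩ : WeierstrassCurve ℤ).Δ →
      ∀ (F : Type) [Field F] [NumberField F], Module.finrank ℚ F = 3 →
      ∀ e : F, e ^ 3 + (1 + 4 * (a₂ : F)) * e ^ 2 + 16 * (a₄ : F) * e + 64 * (a₆ : F) = 0 →
      (∀ κ : ZpExtension F 2, κ.IsCyclotomic → ClassicalMuVanishes κ) ∧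
        ∃ D : ℕ, ∀ κ : ZpExtension F 2, κ.IsCyclotomic → ∀ n : ℕ, ∀ [NumberField ↥(κ.layer n)],
          padicValNat 2 (narrowClassNumber ↥(κ.layer n)) ≤ padicValNat 2 (classNumber ↥(κ.layer n)) + D := by
  intro a₂ a₄ a₆ hodd hirr hnsq F _ _ hF e he
  obtain ⟨W, hE, hM, hord, ht, hsqW, e', he'⟩ := exists_cellCurve_root_of_standardShape_root hodd hirr hnsq he
  exact hL W hord ht hsqW F hF e' he'

/-- ★★★ **SHAPE ⟺ LOCAL.** The named input of C2 in INTEGER-TRIPLE currency («narrow `μ₂⁺ = 0` for every cubic field containing a root of a shape cubic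
`x³ + (1+4a₂)x² + 16a₄x + 64a₆`, `a₄ + a₆` odd, no rational root, `Δ[1,a₂,0,a₄,a₆] ∉ ℤ²`) is EQUIVALENT to the curve-indexed input («narrow `μ₂⁺ = 0` for
every cubic field containing a root of `c_W`, `W/ℚ` elliptic, globally minimal, good ordinary at `2`, `W(ℚ)[2] = 0`, `Δ_W ∉ ℚ²»). UNCONDITIONAL; both sides
are OPEN instances of Iwasawa's `μ = 0` conjecture / Greenberg–Kida; nothing is asserted about them. [cite: SilvermanAEC2009, III.§1 Table 3.1 and VIII.§8 Cor. 8.3]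
[cite: Neron1964] [cite: Greenberg2001IwasawaPastPresent, §4 (Iwasawa's μ = 0 conjecture)] [cite: Kida1982JFields, Thm. 1 (p. 340) and Remark (ii) (p. 341)] -/
theorem narrowMu_standardShape_iff_localCell :
    (∀ a₂ a₄ a₆ : ℤ, Odd (a₄ + a₆) →
      (∀ x : ℚ, x ^ 3 + (1 + 4 * (a₂ : ℚ)) * x ^ 2 + 16 * (a₄ : ℚ) * x + 64 * (a₆ : ℚ) ≠ 0) →
      ¬ IsSquare (⟨1, a₂, 0, a₄, a₆⟩ : WeierstrassCurve ℤ).Δ →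
      ∀ (F : Type) [Field F] [NumberField F], Module.finrank ℚ F = 3 →
      ∀ e : F, e ^ 3 + (1 + 4 * (a₂ : F)) * e ^ 2 + 16 * (a₄ : F) * e + 64 * (a₆ : F) = 0 →
      (∀ κ : ZpExtension F 2, κ.IsCyclotomic → ClassicalMuVanishes κ) ∧
        ∃ D : ℕ, ∀ κ : ZpExtension F 2, κ.IsCyclotomic → ∀ n : ℕ, ∀ [NumberField ↥(κ.layer n)],
          padicValNat 2 (narrowClassNumber ↥(κ.layer n)) ≤ padicValNat 2 (classNumber ↥(κ.layer n)) + D) ↔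
    (∀ (W : WeierstrassCurve ℚ) [W.IsElliptic] [W.IsGloballyMinimal], IsOrdinaryAt W 2 →
      (∀ x : ℚ, ¬ HasRationalTwoTorsionX W x) → ¬ IsSquare W.Δ →
      ∀ (F : Type) [Field F] [NumberField F], Module.finrank ℚ F = 3 → ∀ e : F, aeval e (twoDivisionUCubic W) = 0 →
      (∀ κ : ZpExtension F 2, κ.IsCyclotomic → ClassicalMuVanishes κ) ∧
        ∃ D : ℕ, ∀ κ : ZpExtension F 2, κ.IsCyclotomic → ∀ n : ℕ, ∀ [NumberField ↥(κ.layer n)],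
          padicValNat 2 (narrowClassNumber ↥(κ.layer n)) ≤ padicValNat 2 (classNumber ↥(κ.layer n)) + D) :=
  ⟨fun hS W _ _ ↦ localCell_of_narrowMu_standardShape hS W, narrowMu_standardShape_of_localCell⟩

end Equivalence

/-! ## §2 C2 BY NAME from SHAPE + PRINT⁵ + MuIneqʳ -/

section Cell

/-- ★★★ **SHAPE + PRINT⁵ + MuIneqʳ ⟹ C2 BY NAME.** Granted PRINT {Kato 17.4 (1)(2) at `2` (every curve) `h17`, Greenberg 1999 Thm. 4.1 `hGr`, period unit `hper`,
modularity `hmod`, GZK `hGZK`} and the registered stub MuIneqʳ VERBATIM (`hI`): IF for all integers `a₂, a₄, a₆` with `a₄ + a₆` ODD, `x³ + (1+4a₂)x² + 16a₄x + 64a₆`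
without rational root and `Δ[1,a₂,0,a₄,a₆]` not a square, every cubic number field containing a root of it has (a) `μ = 0` (growth form) along every
cyclotomic `ℤ₂`-extension and (b) bounded narrow `2`-defect along them, THEN `MainConjectureOfRankZeroBSDAtTwo` (§1 SHAPE ⟹ LOCAL, then g33's
`crux_of_forall_cubicField_root_narrowClassicalMu`). The hypothesis is OPEN IN PRINT; nothing is asserted about it. CONDITIONAL; the item stays open;
BSD is NOT proved. [cite: Greenberg2001IwasawaPastPresent, §4 (Iwasawa's μ = 0 conjecture)] [cite: Kida1982JFields, Thm. 1 (p. 340) and Remark (ii) (p. 341)]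
[cite: Kato2004Asterisque, Thm. 17.4 (p. 273) and §17.13 (pp. 279–280)] [cite: GreenbergLNM1716, Thm. 4.1 (p. 102) and Conj. 1.11 (p. 58)] -/
theorem crux_of_forall_standardShape_cubicField_narrowClassicalMu
    (h17 : ∀ (V : WeierstrassCurve ℚ) [V.IsElliptic] [V.IsGloballyMinimal] [NeZero (V.conductorNorm ℤ)]
      (f : CuspForm (Gamma0 (V.conductorNorm ℤ)) 2), kato_divisibility_allPrimes V 2 (f := f))
    (hGr : Greenberg1999.thm41_charValue_rankZero_anyPrime)
    (hper : realPeriodRat_eq_unit_mul_plusPeriod_two) (hmod : nonempty_modularParametrizationData)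
    (hGZK : rank_eq_analyticRank_of_analyticRank_le_one)
    (hI : ∀ (W : WeierstrassCurve ℚ) [W.IsElliptic] [W.IsGloballyMinimal], IsOrdinaryAt W 2 →
      (∀ x : ℚ, ¬ HasRationalTwoTorsionX W x) →
      ∀ (κ : ZpExtension ℚ 2) (γ : Field.absoluteGaloisGroup ℚ), κ.IsCyclotomic →
      κ.IsTopGenerator γ → IsCyclotomicVariable 2 γ →
      ∀ ⦃N : ℕ⦄ [NeZero N] (f : CuspForm (Gamma0 N) 2), IsNewformOf W f →
      ∀ Gp : IwasawaAlgebra 2, iwasawaToPowerSeries 2 Gp = padicLFunction f (unitRoot W 2 : ℚ_[2]) →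
      ∀ (D : W.SelmerDualData κ γ) (Yr : W.FineSelmerDualDataRelaxedInf κ γ),
        lengthAt (IwasawaAlgebra 2) D.X ⟨IwasawaAlgebra.augIdealP 2, IwasawaAlgebra.isPrime_augIdealP_holds 2⟩ ≤
          lengthAt (IwasawaAlgebra 2) (IwasawaAlgebra 2 ⧸ Ideal.span {Gp})
              ⟨IwasawaAlgebra.augIdealP 2, IwasawaAlgebra.isPrime_augIdealP_holds 2⟩ +
            lengthAt (IwasawaAlgebra 2) Yr.X ⟨IwasawaAlgebra.augIdealP 2, IwasawaAlgebra.isPrime_augIdealP_holds 2⟩)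
    (hS : ∀ a₂ a₄ a₆ : ℤ, Odd (a₄ + a₆) →
      (∀ x : ℚ, x ^ 3 + (1 + 4 * (a₂ : ℚ)) * x ^ 2 + 16 * (a₄ : ℚ) * x + 64 * (a₆ : ℚ) ≠ 0) →
      ¬ IsSquare (⟨1, a₂, 0, a₄, a₆⟩ : WeierstrassCurve ℤ).Δ →
      ∀ (F : Type) [Field F] [NumberField F], Module.finrank ℚ F = 3 →
      ∀ e : F, e ^ 3 + (1 + 4 * (a₂ : F)) * e ^ 2 + 16 * (a₄ : F) * e + 64 * (a₆ : F) = 0 →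
      (∀ κ : ZpExtension F 2, κ.IsCyclotomic → ClassicalMuVanishes κ) ∧
        ∃ D : ℕ, ∀ κ : ZpExtension F 2, κ.IsCyclotomic → ∀ n : ℕ, ∀ [NumberField ↥(κ.layer n)],
          padicValNat 2 (narrowClassNumber ↥(κ.layer n)) ≤ padicValNat 2 (classNumber ↥(κ.layer n)) + D) :
    MainConjectureOfRankZeroBSDAtTwo :=
  crux_of_forall_cubicField_root_narrowClassicalMu h17 hGr hper hmod hGZK hI
    (fun W _ _ _ hord ht hsq _ _ F _ _ hF e he ↦ localCell_of_narrowMu_standardShape hS W hord ht hsq F hF e he)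

end Cell

/-! ## §3 The field binders of the restatement menu imply SHAPE -/

section Glue

/-- **v12 («narrow `μ₂⁺ = 0` for every non-cyclic cubic field», g33) ⟹ SHAPE** (a root field of a shape cubic is not Galois over `ℚ`).
[cite: Kida1982JFields, Remark (ii) (p. 341)] [cite: Cohen1993, §6.3.3] -/
theorem standardShape_of_narrowMu_nonGalois_cubic
    (hN : ∀ (F : Type) [Field F] [NumberField F], Module.finrank ℚ F = 3 → ¬ IsGalois ℚ F →
      (∀ κ : ZpExtension F 2, κ.IsCyclotomic → ClassicalMuVanishes κ) ∧
        ∃ D : ℕ, ∀ κ : ZpExtension F 2, κ.IsCyclotomic → ∀ n : ℕ, ∀ [NumberField ↥(κ.layer n)],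
          padicValNat 2 (narrowClassNumber ↥(κ.layer n)) ≤ padicValNat 2 (classNumber ↥(κ.layer n)) + D) :
    ∀ a₂ a₄ a₆ : ℤ, Odd (a₄ + a₆) →
      (∀ x : ℚ, x ^ 3 + (1 + 4 * (a₂ : ℚ)) * x ^ 2 + 16 * (a₄ : ℚ) * x + 64 * (a₆ : ℚ) ≠ 0) →
      ¬ IsSquare (⟨1, a₂, 0, a₄, a₆⟩ : WeierstrassCurve ℤ).Δ →
      ∀ (F : Type) [Field F] [NumberField F], Module.finrank ℚ F = 3 →
      ∀ e : F, e ^ 3 + (1 + 4 * (a₂ : F)) * e ^ 2 + 16 * (a₄ : F) * e + 64 * (a₆ : F) = 0 →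
      (∀ κ : ZpExtension F 2, κ.IsCyclotomic → ClassicalMuVanishes κ) ∧
        ∃ D : ℕ, ∀ κ : ZpExtension F 2, κ.IsCyclotomic → ∀ n : ℕ, ∀ [NumberField ↥(κ.layer n)],
          padicValNat 2 (narrowClassNumber ↥(κ.layer n)) ≤ padicValNat 2 (classNumber ↥(κ.layer n)) + D :=
  fun _ _ _ hodd hirr hnsq F _ _ hF _ he ↦ hN F hF (not_isGalois_of_standardShape_root hodd hirr hnsq hF he)

/-- **g34's dyadic binder («… non-cyclic cubic fields that embed into `ℚ₂`») ⟹ SHAPE** (a root field of a shape cubic is not Galois and embeds into `ℚ₂`).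
[cite: Kida1982JFields, Remark (ii) (p. 341)] [cite: NeukirchANT1999, Ch. II §8 (8.1)–(8.3)] -/
theorem standardShape_of_narrowMu_dyadic
    (hN : ∀ (F : Type) [Field F] [NumberField F], Module.finrank ℚ F = 3 → ¬ IsGalois ℚ F → Nonempty (F →+* ℚ_[2]) →
      (∀ κ : ZpExtension F 2, κ.IsCyclotomic → ClassicalMuVanishes κ) ∧
        ∃ D : ℕ, ∀ κ : ZpExtension F 2, κ.IsCyclotomic → ∀ n : ℕ, ∀ [NumberField ↥(κ.layer n)],
          padicValNat 2 (narrowClassNumber ↥(κ.layer n)) ≤ padicValNat 2 (classNumber ↥(κ.layer n)) + D) :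
    ∀ a₂ a₄ a₆ : ℤ, Odd (a₄ + a₆) →
      (∀ x : ℚ, x ^ 3 + (1 + 4 * (a₂ : ℚ)) * x ^ 2 + 16 * (a₄ : ℚ) * x + 64 * (a₆ : ℚ) ≠ 0) →
      ¬ IsSquare (⟨1, a₂, 0, a₄, a₆⟩ : WeierstrassCurve ℤ).Δ →
      ∀ (F : Type) [Field F] [NumberField F], Module.finrank ℚ F = 3 →
      ∀ e : F, e ^ 3 + (1 + 4 * (a₂ : F)) * e ^ 2 + 16 * (a₄ : F) * e + 64 * (a₆ : F) = 0 →
      (∀ κ : ZpExtension F 2, κ.IsCyclotomic → ClassicalMuVanishes κ) ∧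
        ∃ D : ℕ, ∀ κ : ZpExtension F 2, κ.IsCyclotomic → ∀ n : ℕ, ∀ [NumberField ↥(κ.layer n)],
          padicValNat 2 (narrowClassNumber ↥(κ.layer n)) ≤ padicValNat 2 (classNumber ↥(κ.layer n)) + D :=
  fun _ _ _ hodd hirr hnsq F _ _ hF _ he ↦ hN F hF (not_isGalois_of_standardShape_root hodd hirr hnsq hF he)
    (nonempty_ringHom_padic_two_of_standardShape_root hodd hirr hnsq hF he)

/-- **g34's dyadic-even binder («… that embed into `ℚ₂` and have `v₂(d_F)` even») ⟹ SHAPE** (a root field of a shape cubic is not Galois, embeds into `ℚ₂`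
and has `v₂(d_F)` even): every certificate / filing made for the sharpest FIELD binder of the menu serves the integer-triple binder verbatim. The converse
would be the field-currency exactness (every dyadic-even `S₃`-cubic is a root field of a shape cubic), not claimed. [cite: Kida1982JFields, Remark (ii) (p. 341)]
[cite: Marcus2018, Ch. 2] -/
theorem standardShape_of_narrowMu_dyadicEven
    (hN : ∀ (F : Type) [Field F] [NumberField F], Module.finrank ℚ F = 3 → ¬ IsGalois ℚ F → Nonempty (F →+* ℚ_[2]) →
      Even (padicValInt 2 (NumberField.discr F)) →
      (∀ κ : ZpExtension F 2, κ.IsCyclotomic → ClassicalMuVanishes κ) ∧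
        ∃ D : ℕ, ∀ κ : ZpExtension F 2, κ.IsCyclotomic → ∀ n : ℕ, ∀ [NumberField ↥(κ.layer n)],
          padicValNat 2 (narrowClassNumber ↥(κ.layer n)) ≤ padicValNat 2 (classNumber ↥(κ.layer n)) + D) :
    ∀ a₂ a₄ a₆ : ℤ, Odd (a₄ + a₆) →
      (∀ x : ℚ, x ^ 3 + (1 + 4 * (a₂ : ℚ)) * x ^ 2 + 16 * (a₄ : ℚ) * x + 64 * (a₆ : ℚ) ≠ 0) →
      ¬ IsSquare (⟨1, a₂, 0, a₄, a₆⟩ : WeierstrassCurve ℤ).Δ →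
      ∀ (F : Type) [Field F] [NumberField F], Module.finrank ℚ F = 3 →
      ∀ e : F, e ^ 3 + (1 + 4 * (a₂ : F)) * e ^ 2 + 16 * (a₄ : F) * e + 64 * (a₆ : F) = 0 →
      (∀ κ : ZpExtension F 2, κ.IsCyclotomic → ClassicalMuVanishes κ) ∧
        ∃ D : ℕ, ∀ κ : ZpExtension F 2, κ.IsCyclotomic → ∀ n : ℕ, ∀ [NumberField ↥(κ.layer n)],
          padicValNat 2 (narrowClassNumber ↥(κ.layer n)) ≤ padicValNat 2 (classNumber ↥(κ.layer n)) + D :=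
  fun _ _ _ hodd hirr hnsq F _ _ hF _ he ↦ hN F hF (not_isGalois_of_standardShape_root hodd hirr hnsq hF he)
    (nonempty_ringHom_padic_two_of_standardShape_root hodd hirr hnsq hF he) (even_padicValInt_two_discr_of_standardShape_root hodd hirr hnsq hF he)

end Glue

/-! ## §4 The registered stub PFμ⁺ from SHAPE -/

section Stub

/-- ★★ **THE REGISTERED STUB PFμ⁺ (`PointFieldMuCycAtTwo`, body verbatim) FROM SHAPE.** «narrow `μ₂⁺ = 0` for every cubic field containing a root of a
shape cubic (`a₄ + a₆` odd, no rational root, `Δ ∉ ℤ²`)» ⟹ for every seed-cell `W` (binders of the stub verbatim) and every `i² = −1`: `μ₂ = 0` for every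
cyclotomic `ℤ₂`-extension of `ℚ(W[2]) ⊔ ℚ⟮i⟯`. On the model `ℚ⟮β₀⟯ ∋ 4β₀` (a root of `c_W`): §1 SHAPE ⟹ LOCAL gives narrow `μ₂⁺ = 0` there; then cell
`bsd-2adic`'s Kida-lite ascent and att-p3 g34's ascent to `ℚ(W[2], i)`. With this a skeleton road (b″) {P, LimDoor, MuIneqʳ, PFμ⁺ ⟹ T ⟹ C2} is sorry-free
MODULO {PRINT⁵, LimDoor, MuIneqʳ} and ONE named conjecture on integer triples. CONDITIONAL; nothing closed; BSD is NOT proved.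
[cite: Kida1982JFields, Thm. 1 (p. 340)] [cite: Iwasawa1973MuInvariants, Thm. 2 and Thm. 3, §3–§4] [cite: Greenberg2001IwasawaPastPresent, §4] -/
theorem pointFieldMuCyc_of_forall_standardShape_cubicField_narrowClassicalMu
    (hS : ∀ a₂ a₄ a₆ : ℤ, Odd (a₄ + a₆) →
      (∀ x : ℚ, x ^ 3 + (1 + 4 * (a₂ : ℚ)) * x ^ 2 + 16 * (a₄ : ℚ) * x + 64 * (a₆ : ℚ) ≠ 0) →
      ¬ IsSquare (⟨1, a₂, 0, a₄, a₆⟩ : WeierstrassCurve ℤ).Δ →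
      ∀ (F : Type) [Field F] [NumberField F], Module.finrank ℚ F = 3 →
      ∀ e : F, e ^ 3 + (1 + 4 * (a₂ : F)) * e ^ 2 + 16 * (a₄ : F) * e + 64 * (a₆ : F) = 0 →
      (∀ κ : ZpExtension F 2, κ.IsCyclotomic → ClassicalMuVanishes κ) ∧
        ∃ D : ℕ, ∀ κ : ZpExtension F 2, κ.IsCyclotomic → ∀ n : ℕ, ∀ [NumberField ↥(κ.layer n)],
          padicValNat 2 (narrowClassNumber ↥(κ.layer n)) ≤ padicValNat 2 (classNumber ↥(κ.layer n)) + D) :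
    ∀ (W : WeierstrassCurve ℚ) [W.IsElliptic] [W.IsGloballyMinimal], ¬ W.HasCM →
      IsOrdinaryAt W 2 → (∀ x : ℚ, ¬ HasRationalTwoTorsionX W x) → ¬ IsSquare W.Δ →
      W.analyticRank = 0 → BSDp W 2 →
      ∀ i : AlgebraicClosure ℚ, i ^ 2 = -1 →
      ∀ κL : ZpExtension ↥(W.divisionField 2 ⊔ IntermediateField.adjoin ℚ {i}) 2,
        κL.IsCyclotomic → ClassicalMuVanishes κL := by
  intro W _ _ _ hord ht hsq _ _ i hi κL hκL
  set B : IntermediateField ℚ (AlgebraicClosure ℚ) := ℚ⟮xT W two_ne_zero 0⟯ with hB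
  haveI : FiniteDimensional ℚ ↥B := adjoin.finiteDimensional ((AlgebraicClosure.isAlgebraic ℚ).isAlgebraic _).isIntegral
  haveI : NumberField ↥B := NumberField.mk
  have h3 : Module.finrank ℚ ↥B = 3 := finrank_adjoin_xT_model W ht 0
  have h4mem : (4 : AlgebraicClosure ℚ) * xT W two_ne_zero 0 ∈ B := mul_mem (ofNat_mem B 4) (mem_adjoin_simple_self ℚ _)
  have he : aeval (⟨4 * xT W two_ne_zero 0, h4mem⟩ : ↥B) (twoDivisionUCubic W) = 0 :=
    aeval_mk_eq_zero_of_aeval_eq_zero W B (aeval_four_mul_xT_twoDivisionUCubic W 0) h4mem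
  obtain ⟨hμ, D, hδ⟩ := localCell_of_narrowMu_standardShape hS W hord ht hsq ↥B h3 _ he
  have hodd3 : Odd (Module.finrank ℚ ↥B) := by rw [h3]; decide
  have hP : ∀ κP : ZpExtension ↥(B ⊔ IntermediateField.adjoin ℚ ({i} : Set (AlgebraicClosure ℚ))) 2,
      κP.IsCyclotomic → ClassicalMuVanishes κP :=
    classicalMu_sup_adjoin_of_sq_eq_neg_one_of_narrowDefect_le B hodd3 hi hμ D hδ
  exact (classicalMuVanishes_sup_adjoin_I_iff_pointFieldCM_of_isOrdinaryAt W hord ht hsq hi 0).mpr hP κL hκL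

end Stub

end Summit.BirchSwinnertonDyer.BirchSwinnertonDyer.Theorems.AlignedTransportAtTwoOrdinaryStandardShapeCrux

end
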